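import Mathlib
import HarnessLib
import Summits.NavierStokesRegularity.NavierStokesRegularity.Theorems.TypeILiouvilleAxisymSectors
import Literature.Analysis.FluidPDE.LeiRenZhang2019PeriodicLiouville
import Literature.Analysis.FluidPDE.AxisymOuterBounds

/-!
# TypeILiouvilleAxisymPeriodicSector — crux (L) stmt-NavierStokesRegularity-10661 `TypeIliouvilleL`:
# THE LEI–REN–ZHANG STRATUM (axisymmetric WITH swirl, `Γ` bounded, periodic in `z`) ON PRINT'S CLASS, LOCALIZED

Helper for stmt-NavierStokesRegularity-10661 (`--supports`); theorems only, no definitions, no named-fact hypotheses;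
closes no item; Navier–Stokes regularity is NOT proved here (leafhand seat of the EulerZoomLiouville route; sequel to
`TypeILiouvilleAxisymSectors`).  Class P = print's class of bounded ancient mild solutions.

Inside the axisymmetric-WITH-swirl cell AXL of the (L) residual (KNSS 2009 p. 10 open problem; node `TypeILiouvilleAxisTest`,
whose docstring still lists Lei–Ren–Zhang Thm 1.1 as «in print beyond the tree») the `z`-PERIODIC stratum with bounded
swirl `Γ = x₀v₁ − x₁v₀` is in fact a PROVED tree theorem: `Literature.Analysis.FluidPDE.leiRenZhang2019_liouville_periodic_holds`
(Lei–Ren–Zhang, arXiv:1902.11229 Thm 1.1 = Math. Ann. 383 (2022), De Giorgi–Nash–Moser on `Γ` + KNSS Thm 5.2).  This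
file transports it to class P and localizes every symmetry hypothesis to one patch of one slice:

* §1 `classP_axial_of_axisymmetric_zPeriodic_swirlBounded` — class P + axisymmetric slices + `|Γ| ≤ C` + `z`-periodic
  slices ⟹ ONE constant axial vector `β • e_z` (LRZ + continuity + KNSS Remark 6.1);
  `swirlBounded_of_farField` — `|Γ| ≤ r‖v‖ ≤ R₀K` inside the cylinder `r ≤ R₀`, so the swirl bound is a FAR-FIELD
  condition; `classP_axial_of_axisymmetric_zPeriodic_farFieldSwirl`.
* §2 `classP_axial_of_locally_axisymmetric_locally_zPeriodic` — **a class-P flow which, on ONE nonempty open patch of ONE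
  slice, coincides with all its rotated twins about the axis AND with its translate by a period `P e_z` (`P > 0`), and
  whose swirl is bounded in the far field, is one constant axial vector** (`classP_isAxisymmetric_of_locally`,
  `classP_spacePeriodic_of_locallyPeriodic`, §1); readings on the registered stubs L_Q / S3ᵐ are immediate (the
  conclusion is «one constant vector»).

READING: in the kernel, AXL's open core now excludes (locally certified) `z`-periodic flows with far-field-bounded swirl;
what remains of AXL in print is Lei–Zhang 2011 (`b ∈ L^∞(BMO^{-1})`) and LRZ Thm 1.2 (rate condition on `Γ²`), neither typed
as a sector here.
[cite: LeiRenZhang2019, Thm 1.1 (arXiv:1902.11229 p. 4)] [cite: KochNadirashviliSereginSverak2009, Thm 5.2, Remark 6.1, p. 10 (arXiv:0709.3599)]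
[cite: LemarieRieusset2016, Thm. 9.12 (PDF p. 260)]
-/

noncomputable section

open MeasureTheory Filter Set Function Metric
open scoped Topology
open Literature.Analysis Literature.Analysis.FluidPDE Literature.Analysis.UnboundedOperators
open Summit.NavierStokesRegularity.NavierStokesRegularity.Theorems.TypeILiouvilleShoreline
open Summit.NavierStokesRegularity.NavierStokesRegularity.Theorems.TypeILiouvilleAxisymSectors

set_option linter.dupNamespace false

namespace Summit.NavierStokesRegularity.NavierStokesRegularity.Theorems.TypeILiouvilleAxisymSectors

variable {v : ℝ → EuclideanSpace ℝ (Fin 3) → EuclideanSpace ℝ (Fin 3)}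

/-! ## §1 The Lei–Ren–Zhang stratum on class P -/

/-- **LEI–REN–ZHANG ON CLASS P: axisymmetric (swirl allowed), `|Γ| ≤ C`, `z`-periodic ⟹ ONE constant axial vector.**
Every slice is a.e. `β(t) • e_z` (`leiRenZhang2019_liouville_periodic_holds` on the duality-form package of class P,
`classP_isBoundedAncientMildSolution`), hence equal to it (continuity), and the `β(t)` agree (`classP_sliceConst_agree`).
[cite: LeiRenZhang2019, Thm 1.1 (arXiv:1902.11229 p. 4)] -/
theorem classP_axial_of_axisymmetric_zPeriodic_swirlBounded
    (hc : ContinuousOn (uncurry v) (Iio 0 ×ˢ univ))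
    (hK : ∃ K : ℝ, ∀ t < 0, ∀ x, ‖v t x‖ ≤ K)
    (hd : ∀ t < 0, IsWeaklyDivFree (v t))
    (hm : ∀ s t : ℝ, s < t → t < 0 → ∀ x,
      v t x = heatExtension (v s) (t - s) x - oseenDuhamel 1 s v v t x)
    (haxi : ∀ t < 0, IsAxisymmetric (v t))
    (hsw : ∃ C : ℝ, ∀ t < 0, ∀ x, |swirl (v t) x| ≤ C)
    (hper : ∃ P : ℝ, 0 < P ∧ ∀ t < 0, Function.Periodic (v t) (P • eZ)) :
    ∃ β : ℝ, ∀ t < 0, ∀ x, v t x = β • eZ := by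
  classical
  obtain ⟨hv, hvc, hmeas⟩ := classP_isBoundedAncientMildSolution hc hK hd hm
  have hslice : ∀ t < 0, ∃ β : ℝ, ∀ x, v t x = β • eZ := by
    intro t ht
    obtain ⟨β, hβ⟩ := leiRenZhang2019_liouville_periodic_holds v hv hmeas haxi hsw hper t ht
    have : v t = fun _ => β • eZ :=
      (Continuous.ae_eq_iff_eq volume (hvc t ht) continuous_const).1 hβ
    exact ⟨β, fun x => congrFun this x⟩
  set β : ℝ → ℝ := fun t => if ht : t < 0 then Classical.choose (hslice t ht) else 0 with hβ_def
  have hub : ∀ t < 0, ∀ x, v t x = β t • eZ := by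
    intro t ht x
    have h := Classical.choose_spec (hslice t ht) x
    simp only [hβ_def, dif_pos ht]
    exact h
  have htime := classP_sliceConst_agree hm (b := fun t => β t • eZ) hub
  refine ⟨β (-1), fun t ht x => ?_⟩
  rw [hub t ht x]
  exact htime t (-1) ht (by norm_num)

/-- **The swirl bound is a far-field condition**: `|Γ(x)| ≤ r‖v(x)‖` (`abs_swirl_le_cylRadius_mul_norm'`), so on a bounded
flow a bound `|Γ| ≤ C` for `r ≥ R₀` gives `|Γ| ≤ max C (max R₀ 0 · K)` everywhere. [folklore] -/
theorem swirlBounded_of_farField {S : Set ℝ} {K C R₀ : ℝ}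
    (hK : ∀ t ∈ S, ∀ x, ‖v t x‖ ≤ K)
    (hfar : ∀ t ∈ S, ∀ x, R₀ ≤ cylRadius x → |swirl (v t) x| ≤ C) :
    ∀ t ∈ S, ∀ x, |swirl (v t) x| ≤ max C (max R₀ 0 * K) := by
  intro t ht x
  rcases le_or_gt R₀ (cylRadius x) with h | h
  · exact (hfar t ht x h).trans (le_max_left _ _)
  · have h1 : cylRadius x ≤ max R₀ 0 := h.le.trans (le_max_left _ _)
    have h2 : |swirl (v t) x| ≤ cylRadius x * ‖v t x‖ := abs_swirl_le_cylRadius_mul_norm' x (v t x)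
    calc |swirl (v t) x| ≤ cylRadius x * ‖v t x‖ := h2
      _ ≤ max R₀ 0 * K := mul_le_mul h1 (hK t ht x) (norm_nonneg _) (le_max_right _ _)
      _ ≤ max C (max R₀ 0 * K) := le_max_right _ _

/-- **LRZ on class P with the swirl bound only in the far field** (`r ≥ R₀`). [cite: LeiRenZhang2019, Thm 1.1 (arXiv:1902.11229 p. 4)] -/
theorem classP_axial_of_axisymmetric_zPeriodic_farFieldSwirl
    (hc : ContinuousOn (uncurry v) (Iio 0 ×ˢ univ))
    (hK : ∃ K : ℝ, ∀ t < 0, ∀ x, ‖v t x‖ ≤ K)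
    (hd : ∀ t < 0, IsWeaklyDivFree (v t))
    (hm : ∀ s t : ℝ, s < t → t < 0 → ∀ x,
      v t x = heatExtension (v s) (t - s) x - oseenDuhamel 1 s v v t x)
    (haxi : ∀ t < 0, IsAxisymmetric (v t))
    {C R₀ : ℝ} (hfar : ∀ t < 0, ∀ x, R₀ ≤ cylRadius x → |swirl (v t) x| ≤ C)
    (hper : ∃ P : ℝ, 0 < P ∧ ∀ t < 0, Function.Periodic (v t) (P • eZ)) :
    ∃ β : ℝ, ∀ t < 0, ∀ x, v t x = β • eZ := by
  obtain ⟨K, hKb⟩ := hK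
  have hsw : ∃ C' : ℝ, ∀ t < 0, ∀ x, |swirl (v t) x| ≤ C' :=
    ⟨max C (max R₀ 0 * K), fun t ht x =>
      swirlBounded_of_farField (S := Iio 0) (fun t ht x => hKb t ht x) (fun t ht x hx => hfar t ht x hx) t ht x⟩
  exact classP_axial_of_axisymmetric_zPeriodic_swirlBounded hc ⟨K, hKb⟩ hd hm haxi hsw hper

/-! ## §2 Localized: one rotationally symmetric, `z`-periodic patch of one slice -/

/-- **THE LOCALIZED LEI–REN–ZHANG SECTOR.**  A class-P flow which, on ONE nonempty open patch `U` of ONE slice `t₀ < 0`,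
coincides with all its rotated twins about the axis and with its axial translate by `P e_z` (`P > 0`), and whose swirl
is bounded in the far field `r ≥ R₀`, is ONE constant axial vector: rotational symmetry and `z`-periodicity propagate from
the patch to every slice (`classP_isAxisymmetric_of_locally`, `classP_spacePeriodic_of_locallyPeriodic`), then §1.
[cite: LeiRenZhang2019, Thm 1.1 (arXiv:1902.11229 p. 4); LemarieRieusset2016, Thm. 9.12 (PDF p. 260)] -/
theorem classP_axial_of_locally_axisymmetric_locally_zPeriodic
    (hc : ContinuousOn (uncurry v) (Iio 0 ×ˢ univ))
    (hK : ∃ K : ℝ, ∀ t < 0, ∀ x, ‖v t x‖ ≤ K)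
    (hd : ∀ t < 0, IsWeaklyDivFree (v t))
    (hm : ∀ s t : ℝ, s < t → t < 0 → ∀ x,
      v t x = heatExtension (v s) (t - s) x - oseenDuhamel 1 s v v t x)
    {t₀ : ℝ} (ht₀ : t₀ < 0) {U : Set (EuclideanSpace ℝ (Fin 3))} (hUo : IsOpen U) (hUne : U.Nonempty)
    (hrot : ∀ θ : ℝ, ∀ x ∈ U, v t₀ x = rotZLIE θ (v t₀ ((rotZLIE θ).symm x)))
    {P : ℝ} (hP : 0 < P) (hperloc : ∀ x ∈ U, v t₀ (x + P • eZ) = v t₀ x)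
    {C R₀ : ℝ} (hfar : ∀ t < 0, ∀ x, R₀ ≤ cylRadius x → |swirl (v t) x| ≤ C) :
    ∃ β : ℝ, ∀ t < 0, ∀ x, v t x = β • eZ := by
  have haxi := classP_isAxisymmetric_of_locally hc hK hm ht₀ hUo hUne hrot
  have hperg := classP_spacePeriodic_of_locallyPeriodic hc hK hm (P • eZ) ht₀ hUo hUne hperloc
  have hper : ∃ P : ℝ, 0 < P ∧ ∀ t < 0, Function.Periodic (v t) (P • eZ) :=
    ⟨P, hP, fun t ht x => hperg t ht x⟩
  exact classP_axial_of_axisymmetric_zPeriodic_farFieldSwirl hc hK hd hm haxi hfar hper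

/-- The same with the conclusion of the registered residuals L_Q / BCL / S3ᵐ-Liouville («one constant vector»).
[cite: LeiRenZhang2019, Thm 1.1 (arXiv:1902.11229 p. 4)] -/
theorem classP_const_of_locally_axisymmetric_locally_zPeriodic
    (hc : ContinuousOn (uncurry v) (Iio 0 ×ˢ univ))
    (hK : ∃ K : ℝ, ∀ t < 0, ∀ x, ‖v t x‖ ≤ K)
    (hd : ∀ t < 0, IsWeaklyDivFree (v t))
    (hm : ∀ s t : ℝ, s < t → t < 0 → ∀ x,
      v t x = heatExtension (v s) (t - s) x - oseenDuhamel 1 s v v t x)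
    {t₀ : ℝ} (ht₀ : t₀ < 0) {U : Set (EuclideanSpace ℝ (Fin 3))} (hUo : IsOpen U) (hUne : U.Nonempty)
    (hrot : ∀ θ : ℝ, ∀ x ∈ U, v t₀ x = rotZLIE θ (v t₀ ((rotZLIE θ).symm x)))
    {P : ℝ} (hP : 0 < P) (hperloc : ∀ x ∈ U, v t₀ (x + P • eZ) = v t₀ x)
    {C R₀ : ℝ} (hfar : ∀ t < 0, ∀ x, R₀ ≤ cylRadius x → |swirl (v t) x| ≤ C) :
    ∃ b : EuclideanSpace ℝ (Fin 3), ∀ t < 0, ∀ x, v t x = b := by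
  obtain ⟨β, hβ⟩ := classP_axial_of_locally_axisymmetric_locally_zPeriodic hc hK hd hm ht₀ hUo hUne hrot hP hperloc hfar
  exact ⟨β • eZ, hβ⟩

end Summit.NavierStokesRegularity.NavierStokesRegularity.Theorems.TypeILiouvilleAxisymSectors

end
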